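import Summits.HubbardSuperconductivity.HubbardSuperconductivity.Theorems.AposterioriCapRgSeededBrokenRegimeBoseFermiPinnedAnomalousKernelFloor

/-!
# The anomalous-kernel bound read at the level the cruxes quantify
# (stubs N7 `stub_anomalousKernelOfCertified`, N8 `stub_realisedFloorOfAnomalousKernel` of line `seed-strength-flow`,
# crux `SeededBrokenRegimeBoseFermiPinned` = stmt-HubbardSuperconductivity-14047)

`…AnomalousKernelFloor.lean` (N5) bounds the anomalous quartic kernel of the countertermed effective action by the
scaled remainder norm of EVERY normal form.  The crux's conclusion and the consumer crux R (stmt-13884) do not speak of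
normal forms but of a CERTIFIED DATUM: `D.IsCertifiedEnclosure (hubbardScaleReportCT U μ D h) L₀'` with
`D.MeetsThresholds kStar etaStar` (so `D.remainderNorm.snd ≤ etaStar`).  This file transports N5 through the report's
Kuratowski upper limit in `M` and the enclosure:

* `stub_anomalousKernelOfCertified` (N7): a certified datum forces, for every `L ≥ max L₀' 1`, all `β ≥ β₀(L)` and every
  `δ > 0`, FREQUENTLY in `M`, an admissible frame `K` and a normal form `q` with
  `Λ₀⁻⁵ ε³ ∏ᵢ wt^E_q(Xᵢ) |𝒢̃₄(X)| ≤ D.remainderNorm.snd + δ` at every same-charge configuration `X` (`Λ₀ = D.scale`) — what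
  the consumer of a certified small `η` may use on the non-kept anomalous block;
* `stub_realisedFloorOfAnomalousKernel` (N8): conversely, a lower bound `c` on that anomalous term, uniform over the normal
  forms, is a floor `c ≤ p.remainderNorm` on every realised tuple — the hypothesis shape of the standing disprover's
  `reportFloor_of_realisedFloor` / `noSmallRemainderData_of_tupleFloor` (Disproof.lean §9), whose only remaining input is
  then the MODEL claim that the anomalous `B₁g` block of `𝒢` is bounded below (FLOOR_c2.md: marginal, `h`-uniform).

No model content; folklore bookkeeping on the definitions of `HubbardScaleReportCT.lean` / `HubbardScaleData.lean`.
-/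

set_option linter.dupNamespace false -- `Summit.<S>.<S>` doubles the summit name (tree convention)

namespace Summit.HubbardSuperconductivity.HubbardSuperconductivity.Theorems.AposterioriCapRgSeededBrokenRegimeBoseFermiPinned

open Literature.MathematicalPhysics.QuantumLattice Literature.Probability.LatticeModels GrassmannAlgebra Filter

/-- **N7 (`AnomalousKernelOfCertified`) of line `seed-strength-flow`**: a certified enclosure of the CT report forces,
for every `L ≥ max L₀' 1`, all large `β` and every `δ > 0`, frequently in the Matsubara count `M`, an admissible frame and
a normal form whose energy-weighted anomalous quartic term of the effective action is at most `D.remainderNorm.snd + δ`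
(at the marginal scaling `Λ₀⁻⁵`, `Λ₀ = D.scale`). [folklore] -/
theorem stub_anomalousKernelOfCertified :
    ∀ (U μ h : ℝ) (D : HubbardScaleData) (L₀' : ℕ),
      D.IsCertifiedEnclosure (hubbardScaleReportCT U μ D h) L₀' →
        ∀ L : ℕ, max L₀' 1 ≤ L → ∀ [NeZero L], ∃ β₀ : ℝ, ∀ β : ℝ, β₀ ≤ β → ∀ δ : ℝ, 0 < δ →
          ∃ᶠ M in Filter.atTop, ∃ K : TrigPolyC4v, IsAdmissibleFrame K ∧
            ∃ q : HubbardNormalForm L D.numPatches,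
              ∀ (X : Fin 4 → HubbardFieldIdx L M) (c : Fin 2), (∀ i, (X i).2 = c) →
                (D.scale : ℝ) ^ (-(5 : ℤ)) * ((1 / (β * (L : ℝ) ^ 2)) ^ 3 *
                  ((∏ i, energyLegWeightCT L M β μ h K (D.scale : ℝ) q (X i)) *
                    ‖weightedKernel (1 / (β * (L : ℝ) ^ 2))
                        (hubbardEffectiveActionCT L M β U μ h K (D.scale : ℝ)) 4 X‖)) ≤
                  (D.remainderNorm.snd : ℝ) + δ := by
  intro U μ h D L₀' hcert L hL _
  obtain ⟨β₀, hβ₀⟩ := hcert L (le_of_max_le_left hL)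
  refine ⟨β₀, fun β hβ δ hδ => ?_⟩
  obtain ⟨p, hp, hDp⟩ := hβ₀ β hβ
  rw [hubbardScaleReportCT_eq, mem_hubbardScaleReportCTAt_iff] at hp
  have hηD : p.remainderNorm ≤ (D.remainderNorm.snd : ℝ) := by
    obtain ⟨-, -, -, -, -, hη, -⟩ := hDp
    exact (NonemptyInterval.mem_ratCast_iff.1 hη).2
  refine (hp δ hδ).mono fun M hM => ?_
  obtain ⟨K, hK, p', hp', hclose⟩ := hM
  obtain ⟨q, -, hq⟩ := exists_anomalousKernel_le_of_isRealisedAtCT D.cast_scale_pos hp'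
  refine ⟨K, hK, q, fun X c hX => (hq X c hX).trans ?_⟩
  have hc := hclose.2.2.2.2.2.1
  rw [abs_lt] at hc
  linarith

/-- **N8 (`RealisedFloorOfAnomalousKernel`) of line `seed-strength-flow`**: a lower bound `c` on the energy-weighted
anomalous quartic term of the effective action, uniform over the normal forms, is a remainder FLOOR on every realised
tuple: `c ≤ p.remainderNorm` whenever `IsRealisedAtCT … p` (the input shape of Disproof.lean §9
`reportFloor_of_realisedFloor`). [folklore] -/
theorem stub_realisedFloorOfAnomalousKernel :
    ∀ (L M Np : ℕ) [NeZero L] (β U μ h : ℝ) (K : TrigPolyC4v) (Λ₀ c : ℝ) (nodal : Finset (Fin Np)),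
      0 < Λ₀ →
        (∀ q : HubbardNormalForm L Np, ∃ X : Fin 4 → HubbardFieldIdx L M, ∃ c' : Fin 2, (∀ i, (X i).2 = c') ∧
          c ≤ Λ₀ ^ (-(5 : ℤ)) * ((1 / (β * (L : ℝ) ^ 2)) ^ 3 *
            ((∏ i, energyLegWeightCT L M β μ h K Λ₀ q (X i)) *
              ‖weightedKernel (1 / (β * (L : ℝ) ^ 2)) (hubbardEffectiveActionCT L M β U μ h K Λ₀) 4 X‖))) →
        ∀ p : HubbardScaleData.Parameters Np, IsRealisedAtCT L M β U μ h K Λ₀ Np nodal p → c ≤ p.remainderNorm := by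
  intro L M Np _ β U μ h K Λ₀ c nodal hΛ hfloor p hp
  obtain ⟨hβ, q, -, -, -, -, -, -, -, hη⟩ := hp
  obtain ⟨X, c', hX, hc⟩ := hfloor q
  exact hc.trans ((stub_anomalousKernelFloor L M Np β U μ h K Λ₀ q X c' hβ hΛ hX).trans hη)

end Summit.HubbardSuperconductivity.HubbardSuperconductivity.Theorems.AposterioriCapRgSeededBrokenRegimeBoseFermiPinned
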